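import Literature.MathematicalPhysics.QuantumLattice.HubbardRingPerronFrobeniusProofs
import Literature.MathematicalPhysics.QuantumLattice.HubbardModelProofs
import Literature.MathematicalPhysics.QuantumLattice.HubbardHubbardModelEtaPairingProofs
import Literature.MathematicalPhysics.QuantumLattice.HubbardHubbardModelEtaODLROProofs
import Literature.MathematicalPhysics.QuantumLattice.HubbardSzSectorLadder
import Literature.MathematicalPhysics.QuantumLattice.FermionOperatorsProofs
import Literature.MathematicalPhysics.QuantumLattice.SectorEigenvalueContinuation
import Literature.MathematicalPhysics.QuantumLattice.DopedRVBState
import HarnessLib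

/-!
# Crux `MesoscopicPairOrder` (item `stmt-HubbardSuperconductivity-7331`), line `SketchIdeator4` —
# stub `stub_lowestWeightCriterion` (Yang–Zhang lowest-weight selection of doped ground states)

Helper file (lands `--supports stmt-HubbardSuperconductivity-7331`; the composition lives in the lead's
skeleton `Cruxes/MesoscopicPairOrder/Lines/SketchIdeator4.lean`, route `FunctionFieldCertificate`).
Objects: the pure Hubbard Hamiltonian `H = hubbardTorus 2 L 1 U` on the fermionic torus `(ℤ/Lℤ)²`,
Yang's operators `η† = etaRaise torusStagger = Σ_z (-1)^z c†_{z↑} c†_{z↓}`, `η = etaLower torusStagger`,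
and the joint sectors `szSector N 0` (`N` electrons, `S^z = 0`) with sector energies
`E(N, 0) = H.minEnergyOn (szSector N 0)`.

* `hubbardTorus_commute_etaRaise_mul_etaLower` — the pseudospin Casimir part `η†η` is conserved at
  EVERY filling on the torus of even side: `[H, η†η] = [H, η†]η + η†[H, η] = U η†η - U η†η = 0`
  (Yang's `[H, η†] = U η†`, tree `hamiltonian_commutator_etaRaise`, and its adjoint).
* `stub_lowestWeightCriterion` — the registered stub: if `E(2n+2, 0) < E(2n, 0) + U` then every
  ground state `ψ` of the sector `(2n+2, 0)` satisfies `η ψ = 0` (it is the lowest-weight vector of its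
  pseudospin multiplet). Proof: `ηψ` lies in the sector `(n, n)`; `H(ηψ) = (E(2n+2,0) - U) ηψ` by
  `[H, η] = -U η`; the variational principle in `szSector (2n) 0` gives
  `E(2n, 0)‖ηψ‖² ≤ (E(2n+2, 0) - U)‖ηψ‖²`, so `ηψ = 0`.

No definition is introduced. Yang, PRL 63 (1989) 2144, eqs. (4)–(6); Yang–Zhang, Mod. Phys. Lett. B 4
(1990) 759, Theorem 1; Tasaki (2020) §2.1 (variational principle). Folklore computation.
-/

noncomputable section

-- the summit namespace repeats the problem name by design (D-0017)
set_option linter.dupNamespace false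

namespace Summit.HubbardSuperconductivity.HubbardSuperconductivity.Theorems.FunctionFieldCertificate

open Matrix Finset
open Literature.Probability.LatticeModels Literature.MathematicalPhysics.QuantumLattice
open Literature.MathematicalPhysics.QuantumLattice.EigenvalueContinuation
  (re_star_dotProduct_self_nonneg re_star_dotProduct_self_pos)
open scoped ComplexOrder

/-- **Yang's commutator and its adjoint on the even torus.** For every `U` and every even side `L`:
`H η† = U η† + η† H` and `H η = η H - U η`, where `H = hubbardTorus 2 L 1 U`,
`η† = etaRaise torusStagger`, `η = etaLower torusStagger`. Yang, PRL 63 (1989) 2144, eq. (5).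
[folklore] -/
theorem hubbardTorus_mul_etaRaise_and_mul_etaLower (U : ℝ) (L : ℕ) (hL : Even L) :
    hubbardTorus 2 L 1 U * etaRaise torusStagger =
        (U : ℂ) • etaRaise torusStagger + etaRaise torusStagger * hubbardTorus 2 L 1 U ∧
      hubbardTorus 2 L 1 U * etaLower torusStagger =
        etaLower torusStagger * hubbardTorus 2 L 1 U -
          (U : ℂ) • etaLower (torusStagger : FermionTorus 2 L → ℤˣ) := by
  set H := hubbardTorus 2 L 1 U with hH
  have hHG : H = hamiltonian (fermionTorusGraph 2 L) 1 U := rfl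
  have hcomm := hamiltonian_commutator_etaRaise (fermionTorusGraph 2 L) torusStagger
    (fun x y h => torusStagger_eq_neg_of_adj_holds hL h) 1 U
  rw [← hHG] at hcomm
  have hHerm : Hᴴ = H :=
    (hamiltonian_isHermitian_and_commute_holds (fermionTorusGraph 2 L) 1 U).1.eq
  have h1 : H * etaRaise torusStagger =
      (U : ℂ) • etaRaise torusStagger + etaRaise torusStagger * H :=
    sub_eq_iff_eq_add.1 hcomm
  have h2 : etaLower torusStagger * H =
      (U : ℂ) • etaLower torusStagger + H * etaLower (torusStagger : FermionTorus 2 L → ℤˣ) := by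
    have := congrArg Matrix.conjTranspose h1
    simpa [Matrix.conjTranspose_mul, Matrix.conjTranspose_add, Matrix.conjTranspose_smul, hHerm,
      etaLower, Complex.star_def, Complex.conj_ofReal] using this
  refine ⟨h1, ?_⟩
  rw [h2]; abel

/-- **The pseudospin Casimir part `η†η` is conserved at every filling.** On the torus of even side
the pure Hubbard Hamiltonian commutes with `η†η` for every `U`:
`[H, η†η] = [H, η†]η + η†[H, η] = U η†η - U η†η = 0`. (Doping does not break the `SO(4)` structure;
it only fixes `η^z = (N̂ - L²)/2`.) Yang–Zhang, Mod. Phys. Lett. B 4 (1990) 759, Theorem 1.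
[folklore] -/
theorem hubbardTorus_commute_etaRaise_mul_etaLower (U : ℝ) (L : ℕ) (hL : Even L) :
    Commute (hubbardTorus 2 L 1 U)
      (etaRaise torusStagger * etaLower (torusStagger : FermionTorus 2 L → ℤˣ)) := by
  obtain ⟨h1, h3⟩ := hubbardTorus_mul_etaRaise_and_mul_etaLower U L hL
  show hubbardTorus 2 L 1 U * (etaRaise torusStagger * etaLower torusStagger) =
    etaRaise torusStagger * etaLower torusStagger * hubbardTorus 2 L 1 U
  rw [← mul_assoc, h1, add_mul, smul_mul_assoc, mul_assoc, h3, mul_sub, mul_smul_comm, ← mul_assoc]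
  abel

/-- **Stub `stub_lowestWeightCriterion`** of line `SketchIdeator4` (Yang–Zhang lowest-weight
selection). On the torus of even side `L`, for every `U` and every `n` with `2n + 2 ≤ L²`: if the
pair chemical potential of the `S^z = 0` sectors is STRICTLY below `U`,
`E(2n+2, 0) < E(2n, 0) + U` (`E(N, 0) = minEnergyOn (hubbardTorus 2 L 1 U) (szSector N 0)`), then
every ground state `ψ` of the sector `(2n+2, S^z = 0)` is annihilated by Yang's
`η = etaLower torusStagger = Σ_z (-1)^z c_{z↓} c_{z↑}` — it is the lowest-weight vector `|j, -j⟩`,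
`j = (L² - 2n - 2)/2`, of its pseudospin multiplet. Proof: `ηψ ∈ szSector (2n) 0`;
`H(ηψ) = (E(2n+2, 0) - U) ηψ` by `[H, η] = -U η`; the variational principle gives
`E(2n, 0)‖ηψ‖² ≤ (E(2n+2, 0) - U)‖ηψ‖²`, hence `(E(2n,0) - E(2n+2,0) + U)‖ηψ‖² ≤ 0` with a positive
bracket. Yang, PRL 63 (1989) 2144, eqs. (5)–(6); Yang–Zhang, Mod. Phys. Lett. B 4 (1990) 759,
Theorem 1; Tasaki (2020) §2.1. [folklore] -/
theorem stub_lowestWeightCriterion : ∀ (U : ℝ) (L : ℕ) [NeZero L], Even L → ∀ n : ℕ,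
    2 * n + 2 ≤ L ^ 2 →
    (hubbardTorus 2 L 1 U).minEnergyOn (szSector (2 * (n + 1)) 0) <
        (hubbardTorus 2 L 1 U).minEnergyOn (szSector (2 * n) 0) + U →
      ∀ ψ : Fock (Orb (FermionTorus 2 L)),
        IsGroundStateInSector (hubbardTorus 2 L 1 U) (2 * (n + 1)) 0 ψ →
          etaLower (torusStagger : FermionTorus 2 L → ℤˣ) *ᵥ ψ = 0 := by
  intro U L _ hL n hn hgap ψ hgs
  set H := hubbardTorus 2 L 1 U with hH
  have hHG : H = hamiltonian (fermionTorusGraph 2 L) 1 U := rfl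
  obtain ⟨hψS, hψ0, hHψ⟩ := hgs
  have hψsec : IsInSector (n + 1) (n + 1) ψ := (mem_szSector_two_mul_zero_iff (n + 1) ψ).1 hψS
  set E₂ : ℝ := H.minEnergyOn (szSector (2 * (n + 1)) 0) with hE₂
  set E₀ : ℝ := H.minEnergyOn (szSector (2 * n) 0) with hE₀
  set φ : Fock (Orb (FermionTorus 2 L)) := etaLower torusStagger *ᵥ ψ with hφ
  -- (1) `φ = ηψ` lies in the sector `(n, n)`
  have hφsec : IsInSector n n φ := by
    rw [hφ, etaLower_eq_sum_holds, sum_mulVec]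
    refine IsInSector.sum fun x _ => ?_
    rw [smul_mulVec, ← mulVec_mulVec]
    exact ((hψsec.annihilation_up_mulVec x).annihilation_down_mulVec x).smul _
  -- (2) Yang's commutator, lowered: `H η = η H - U η`
  have h3 := (hubbardTorus_mul_etaRaise_and_mul_etaLower U L hL).2
  rw [← hH] at h3
  -- (3) `φ` is an eigenvector with eigenvalue `E₂ - U`
  have hHφ : H *ᵥ φ = ((E₂ - U : ℝ) : ℂ) • φ := by
    show H *ᵥ (etaLower torusStagger *ᵥ ψ) = ((E₂ - U : ℝ) : ℂ) • (etaLower torusStagger *ᵥ ψ)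
    rw [mulVec_mulVec, h3, sub_mulVec, smul_mulVec, ← mulVec_mulVec, hHψ, mulVec_smul, ← sub_smul]
    congr 1
    push_cast
    ring
  have hexp : (expect H φ).re = (E₂ - U) * (star φ ⬝ᵥ φ).re := by
    rw [Literature.MathematicalPhysics.QuantumLattice.expect, hHφ, dotProduct_smul, smul_eq_mul,
      Complex.re_ofReal_mul]
  -- (4) variational principle in the sector `(n, n)`
  have hcard : Fintype.card (FermionTorus 2 L) = L ^ 2 := card_fermionTorus 2 L
  have hn0 : n ≤ Fintype.card (FermionTorus 2 L) := by rw [hcard]; omega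
  have hvar := (szSector_groundState (fermionTorusGraph 2 L) 1 U hn0).2 φ hφsec
  rw [← hHG, hexp] at hvar
  -- (5) conclude: `(E₀ - E₂ + U) ‖φ‖² ≤ 0` with a positive bracket
  by_contra hφ0
  have hpos := re_star_dotProduct_self_pos hφ0
  have hgap' : 0 < E₀ - E₂ + U := by rw [hE₀, hE₂]; linarith
  nlinarith

end Summit.HubbardSuperconductivity.HubbardSuperconductivity.Theorems.FunctionFieldCertificate
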